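import Summits.QuantumFields.YangMills.Theses.ParabolicTrajectory
import Literature.Probability.LatticeModels.GibbsSpecification
import Literature.MathematicalPhysics.QuantumFieldTheory.YangMillsOS
import Mathlib.Probability.Moments.Covariance
import Summits.QuantumFields.YangMills.Theorems.ParabolicTrajectoryLatticeGapOnTrajectoryDefs
import Summits.QuantumFields.YangMills.Theorems.ParabolicTrajectoryLatticeGapOnTrajectoryStubTorusFramesWalk

/-!
# Route `ParabolicTrajectory`, crux `LatticeGapOnTrajectory` (stmt-QuantumFields-10523),
# line `orbit-kantorovich-finite-size`: stub `stub_torusFrames`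

Proof of `TorusFramesExist` (the statement consumed by `stub_smoothingToGap`), pure `ZMod`
combinatorics:

* Clause (1): for every torus frame `q : ZMod N → ZMod (μ+1)` of scale `b` (a `0/1`-step label
  map whose fibres are cyclic arcs of length in `[b, 2b]`) the cyclic site distance is controlled
  by the cyclic label distance, `|y − x| ≤ 2b (|q y − q x| + 1)`. Walk from `x` to `y` and back
  round the cycle counting label increments (`inc`): the `n + 1` sites of a walk of `n < N` steps
  with `k` increments lie in `k + 1` fibres of `≤ 2b` sites each, and the increments of the two
  complementary walks add up to a multiple of `μ + 1` that is at most `μ + 1` (label maps are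
  injective on arc right-endpoints).
* Clause (2): for `(2n₀+3)·2b ≤ N`, `4w + 4 ≤ b` and centres `x₁, x₂` (swapped so that
  `(x₂ - x₁).val ≤ N/2`), the uniform frame `z ↦ min ((z - o).val / b) K`, `K + 1 = N / b`, with
  origin `o = x₁ - w - v` and a slide `v ≤ 2w` making `((x₂ - x₁).val + v) % b + 2w < b`, has
  `≥ 2n₀ + 3` cells of length `b` (the last one of length `b + N % b`) and keeps both arcs
  `xᵢ - w, …, xᵢ + w` inside one cell.
-/

/-! Part TWO of two: uniform frames with a well-placed origin (`part_two`) and the registered stub `stub_torusFrames`;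
part one (`part_one`) is `…StubTorusFramesWalk.lean`. -/

namespace Summit.QuantumFields.YangMills.Cruxes.LatticeGapOnTrajectory.OrbitKantorovichFiniteSize
open scoped BigOperators Topology ENNReal ProbabilityTheory
open Filter MeasureTheory
open Literature.Probability.LatticeModels (Specification IsSpecification IsGibbsMeasure glueWith)
open Literature.MathematicalPhysics.QuantumFieldTheory
noncomputable section


namespace StubTorusFrames

variable {N m : ℕ}

/-! ### Part (2): uniform frames with a well-placed origin

The frame: origin `o`, cells `o + [ib, (i+1)b)` for `i < K` and the last cell `o + [Kb, N)` (of
length `b + N % b < 2b`), where `K + 1 = N / b`. The origin is `x₁ - w - v` with a slide `v ≤ 2w`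
chosen so that the second arc does not straddle a cut (`(D + v) % b + 2w < b`,
`D = (x₂ - x₁).val ≤ N / 2` after swapping). -/

/-- Label of the offset `t`: `min (t / b) K`. -/
def ulabel (b K t : ℕ) : ℕ := min (t / b) K

/-- The uniform frame of scale `b` with `K + 1` cells and origin `o`. -/
def uframe (N b K : ℕ) (o : ZMod N) (z : ZMod N) : ZMod (K + 1) :=
  ((ulabel b K (z - o).val : ℕ) : ZMod (K + 1))

/-- One step changes the label by `0` or `1`. -/
theorem ulabel_succ (b K t : ℕ) (hb : 0 < b) :
    ulabel b K (t + 1) = ulabel b K t ∨ ulabel b K (t + 1) = ulabel b K t + 1 := by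
  have h1 : t / b ≤ (t + 1) / b := Nat.div_le_div_right (Nat.le_succ t)
  have h2 : (t + 1) / b ≤ t / b + 1 := by
    calc (t + 1) / b ≤ (t + b) / b := Nat.div_le_div_right (by omega)
      _ = t / b + 1 := Nat.add_div_right t hb
  unfold ulabel
  omega

/-- The fibres of `ulabel` below `N`: `[ib, ib + b)` for `i < K` and `[Kb, N)` for `i = K`. -/
theorem ulabel_eq_iff {b K N t i : ℕ} (hb : 0 < b) (hKN : K * b + b ≤ N) (ht : t < N)
    (hi : i ≤ K) : ulabel b K t = i ↔ i * b ≤ t ∧ t < i * b + (if i < K then b else N - K * b) := by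
  have e1 : i ≤ t / b ↔ i * b ≤ t := Nat.le_div_iff_mul_le hb
  have e2 : t / b < i + 1 ↔ t < (i + 1) * b := Nat.div_lt_iff_lt_mul hb
  have e3 : K ≤ t / b ↔ K * b ≤ t := Nat.le_div_iff_mul_le hb
  have e4 : (i + 1) * b = i * b + b := Nat.succ_mul i b
  unfold ulabel
  split_ifs with hiK
  · have e5 : i * b + b ≤ K * b := by
      have := Nat.mul_le_mul_right b hiK; rwa [Nat.succ_mul] at this
    omega
  · have hi' : i = K := by omega
    subst hi'
    omega

/-- The uniform frame has the `0/1`-step property (including the wrap `N - 1 ↦ 0`, label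
`K ↦ K + 1 = 0`). -/
theorem uframe_step [NeZero N] {b K : ℕ} (hb : 0 < b) (hK : K + 1 = N / b) (o z : ZMod N) :
    uframe N b K o (z + 1) = uframe N b K o z ∨ uframe N b K o (z + 1) = uframe N b K o z + 1 := by
  unfold uframe
  set t := (z - o).val with ht
  have htN : t < N := ZMod.val_lt _
  have hzo : z + 1 - o = ((t + 1 : ℕ) : ZMod N) := by
    rw [Nat.cast_succ, ht, ZMod.natCast_zmod_val]; ring
  rw [hzo, ZMod.val_natCast]
  obtain hlt | heq : t + 1 < N ∨ t + 1 = N := by omega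
  · rw [Nat.mod_eq_of_lt hlt]
    rcases ulabel_succ b K t hb with h | h
    · left; rw [h]
    · right; rw [h, Nat.cast_succ]
  · right
    rw [heq, Nat.mod_self]
    have hKt : ulabel b K t = K := by
      unfold ulabel
      apply min_eq_right
      rw [Nat.le_div_iff_mul_le hb]
      have h2 : N / b * b ≤ N := Nat.div_mul_le_self N b
      rw [← hK, Nat.succ_mul] at h2
      omega
    have h0 : ulabel b K 0 = 0 := by simp [ulabel]
    rw [hKt, h0, Nat.cast_zero, ← Nat.cast_succ, ZMod.natCast_self]

/-- The fibres of the uniform frame are arcs of length in `[b, 2b]`. -/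
theorem uframe_fibre [NeZero N] {b K : ℕ} (hb : 0 < b) (hK : K + 1 = N / b) (o : ZMod N)
    (c : ZMod (K + 1)) : ∃ (a : ZMod N) (ℓ : ℕ), b ≤ ℓ ∧ ℓ ≤ 2 * b ∧
      ∀ z : ZMod N, uframe N b K o z = c ↔ ∃ j : ℕ, j < ℓ ∧ z = a + j := by
  have hdm : b * (K + 1) + N % b = N := by rw [hK]; exact Nat.div_add_mod N b
  have hml : N % b < b := Nat.mod_lt N hb
  have hKb : b * (K + 1) = K * b + b := by ring
  obtain ⟨i, hic, hiK⟩ : ∃ i : ℕ, c = (i : ZMod (K + 1)) ∧ i ≤ K :=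
    ⟨c.val, (ZMod.natCast_zmod_val c).symm, Nat.le_of_lt_succ (ZMod.val_lt c)⟩
  subst hic
  obtain ⟨ℓ, hℓdef, hℓN, hbℓ, hℓb⟩ :
      ∃ ℓ, (if i < K then b else N - K * b) = ℓ ∧ i * b + ℓ ≤ N ∧ b ≤ ℓ ∧ ℓ ≤ 2 * b :=
      by
    refine ⟨_, rfl, ?_, ?_, ?_⟩
    · split_ifs with h
      · have := Nat.mul_le_mul_right b h; rw [Nat.succ_mul] at this; omega
      · rw [show i = K by omega]; omega
    · split_ifs <;> omega
    · split_ifs <;> omega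
  refine ⟨o + ((i * b : ℕ) : ZMod N), ℓ, hbℓ, hℓb, fun z => ?_⟩
  unfold uframe
  set t := (z - o).val with ht
  have htN : t < N := ZMod.val_lt _
  have hz : z = o + ((t : ℕ) : ZMod N) := by rw [ht, ZMod.natCast_zmod_val]; ring
  have hul : ulabel b K t < K + 1 := Nat.lt_succ_of_le (min_le_right _ _)
  rw [ZMod.natCast_eq_natCast_iff', Nat.mod_eq_of_lt hul, Nat.mod_eq_of_lt (Nat.lt_succ_of_le hiK),
    ulabel_eq_iff hb (by omega) htN hiK, hℓdef]
  constructor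
  · rintro ⟨h1, h2⟩
    refine ⟨t - i * b, by omega, ?_⟩
    rw [hz, add_assoc, ← Nat.cast_add, show i * b + (t - i * b) = t by omega]
  · rintro ⟨j, hj, hzj⟩
    have htj : t = i * b + j := by
      have e : ((t : ℕ) : ZMod N) = ((i * b + j : ℕ) : ZMod N) := by
        have := hz.symm.trans hzj
        push_cast at this ⊢
        linear_combination this
      rwa [ZMod.natCast_eq_natCast_iff', Nat.mod_eq_of_lt htN, Nat.mod_eq_of_lt (by omega)] at e
    constructor <;> omega

/-- On an offset window `[s, s + j]` not straddling a cut (`s % b + j < b`) the label is constant: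
`(s + j) / b = s / b`. -/
theorem div_add_eq_div {b s j : ℕ} (hb : 0 < b) (hj : s % b + j < b) : (s + j) / b = s / b := by
  conv_lhs => rw [← Nat.div_add_mod s b, add_assoc, Nat.mul_add_div hb, Nat.div_eq_of_lt hj]
  rfl

/-- **Clause (2)** when `x₂` is at most half a turn ahead of `x₁`. -/
theorem frame_exists_of_val_le (n₀ N b w : ℕ) (x₁ x₂ : ZMod N) [NeZero N] (hb : 1 ≤ b)
    (hw : 4 * w + 4 ≤ b) (hN : (2 * n₀ + 3) * (2 * b) ≤ N) (hD : (x₂ - x₁).val ≤ N / 2) :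
    ∃ (μ : ℕ) (q : ZMod N → ZMod (μ + 1)), 2 * n₀ + 3 ≤ μ + 1 ∧ IsTorusFrame N b q ∧
      (∀ j : ℕ, j ≤ 2 * w → q (x₁ - (w : ZMod N) + (j : ZMod N)) = q x₁) ∧
      (∀ j : ℕ, j ≤ 2 * w → q (x₂ - (w : ZMod N) + (j : ZMod N)) = q x₂) := by
  have hb0 : 0 < b := hb
  have hNb : (2 * n₀ + 3) * 2 ≤ N / b := by
    rw [Nat.le_div_iff_mul_le hb0, mul_assoc]; exact hN
  have h6 : 6 * b ≤ N :=
    calc 6 * b = 3 * (2 * b) := by ring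
      _ ≤ (2 * n₀ + 3) * (2 * b) := Nat.mul_le_mul_right _ (by omega)
      _ ≤ N := hN
  set K := N / b - 1 with hKdef
  have hK : K + 1 = N / b := by omega
  -- the shift `D` and the slide `v`
  set D := (x₂ - x₁).val with hDdef
  have hx₂ : x₂ = x₁ + (D : ZMod N) := by rw [hDdef, ZMod.natCast_zmod_val]; ring
  obtain ⟨v, hv1, hv2⟩ : ∃ v : ℕ, v + 2 * w < b ∧ (D + v) % b + 2 * w < b := by
    by_cases h : D % b + 2 * w < b
    · exact ⟨0, by omega, by rw [add_zero]; exact h⟩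
    · have hrb : D % b < b := Nat.mod_lt D hb0
      refine ⟨b - D % b, by omega, ?_⟩
      have : D + (b - D % b) = b * (D / b + 1) := by
        have := Nat.div_add_mod D b; rw [mul_add, mul_one]; omega
      rw [this, Nat.mul_mod_right]; omega
  set o : ZMod N := x₁ - (w : ZMod N) - (v : ZMod N) with ho
  refine ⟨K, uframe N b K o, by omega, ⟨uframe_step hb0 hK o, uframe_fibre hb0 hK o⟩, ?_, ?_⟩
  · intro j hj
    have e1 : x₁ - (w : ZMod N) + (j : ZMod N) - o = ((v + j : ℕ) : ZMod N) := by
      rw [ho]; push_cast; ring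
    have e2 : x₁ - o = ((v + w : ℕ) : ZMod N) := by rw [ho]; push_cast; ring
    unfold uframe ulabel
    rw [e1, e2, ZMod.val_natCast, ZMod.val_natCast, Nat.mod_eq_of_lt (by omega),
      Nat.mod_eq_of_lt (by omega), Nat.div_eq_of_lt (by omega), Nat.div_eq_of_lt (by omega)]
  · intro j hj
    have e1 : x₂ - (w : ZMod N) + (j : ZMod N) - o = ((D + v + j : ℕ) : ZMod N) := by
      rw [hx₂, ho]; push_cast; ring
    have e2 : x₂ - o = ((D + v + w : ℕ) : ZMod N) := by rw [hx₂, ho]; push_cast; ring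
    unfold uframe ulabel
    rw [e1, e2, ZMod.val_natCast, ZMod.val_natCast, Nat.mod_eq_of_lt (by omega),
      Nat.mod_eq_of_lt (by omega), div_add_eq_div (s := D + v) (j := j) hb0 (by omega),
      div_add_eq_div (s := D + v) (j := w) hb0 (by omega)]

/-- **Clause (2)**: swap `x₁, x₂` so that `(x₂ - x₁).val ≤ N / 2`. -/
theorem part_two (n₀ N b w : ℕ) (x₁ x₂ : ZMod N) [NeZero N] (hb : 1 ≤ b) (hw : 4 * w + 4 ≤ b)
    (hN : (2 * n₀ + 3) * (2 * b) ≤ N) :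
    ∃ (μ : ℕ) (q : ZMod N → ZMod (μ + 1)), 2 * n₀ + 3 ≤ μ + 1 ∧ IsTorusFrame N b q ∧
      (∀ j : ℕ, j ≤ 2 * w → q (x₁ - (w : ZMod N) + (j : ZMod N)) = q x₁) ∧
      (∀ j : ℕ, j ≤ 2 * w → q (x₂ - (w : ZMod N) + (j : ZMod N)) = q x₂) := by
  by_cases hD : (x₂ - x₁).val ≤ N / 2
  · exact frame_exists_of_val_le n₀ N b w x₁ x₂ hb hw hN hD
  · have hD' : (x₁ - x₂).val ≤ N / 2 := by
      have hne : x₂ - x₁ ≠ 0 := by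
        intro h; rw [h, ZMod.val_zero] at hD; exact hD (Nat.zero_le _)
      rw [← neg_sub, ZMod.neg_val, if_neg hne]
      have := ZMod.val_lt (x₂ - x₁); omega
    obtain ⟨μ, q, h1, h2, h3, h4⟩ := frame_exists_of_val_le n₀ N b w x₂ x₁ hb hw hN hD'
    exact ⟨μ, q, h1, h2, h4, h3⟩

end StubTorusFrames

/-- **Torus frames exist and are coarse-Lipschitz** (`TorusFramesExist`, pure `ZMod` combinatorics).
(1) For every torus frame of scale `b` on `ℤ/N`, the cyclic site distance is at most `2b` times
(the cyclic label distance `+ 1`): walk both ways round, count label increments, and use that every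
fibre has `≤ 2b` sites while the total number of increments round the cycle is `0` or the number of
labels.
(2) For `(2n₀+3)·2b ≤ N`, `4w + 4 ≤ b` and two centres `x₁, x₂`, the uniform frame (cells
`[ib, (i+1)b)` and a last cell of length `b + N % b`) with origin `x₁ - w - v`, the slide `v ≤ 2w`
chosen so that the second arc does not straddle a cut, has `N / b ≥ 2n₀ + 3` cells and keeps both
arcs `xᵢ - w, …, xᵢ + w` inside one cell. -/
theorem stub_torusFrames : TorusFramesExist :=
  ⟨fun N b μ q _ _ hq x y => StubTorusFrames.part_one N b μ q hq x y,
    fun n₀ N b w x₁ x₂ _ hb hw hN => StubTorusFrames.part_two n₀ N b w x₁ x₂ hb hw hN⟩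

end

end Summit.QuantumFields.YangMills.Cruxes.LatticeGapOnTrajectory.OrbitKantorovichFiniteSize
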